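import Literature.MathematicalPhysics.QuantumFieldTheory.Balaban1983to89.B9Eq34CovCurlVector

/-!
# `Balaban1983to89.B11Eq135WeitzenbockCarrier` — T. Bałaban, *The variational problem and background fields in renormalization group method for
# lattice gauge theories*, Commun. Math. Phys. **102** (1985) 277–309 [Balaban1985Variational] (134)–(135) p. 298 with [Balaban1985BackgroundPropagators]
# (3.3)–(3.4), (3.8)–(3.10), (3.23) pp. 390–394: **THE LATTICE WEITZENBÖCK IDENTITY `D*D + DD* = Δ_U − η⁻²𝒦` ON THE CHAIN's CARRIER** — for fibre-valued
# bond functions on the periodic lattice `B9SectCLatticeCarrier` with ARBITRARY linear transporter data `R`, `S` (the letters of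
# `B9Eq33CovDerivVector.covDeriv` ∕ `covDiv` and `B9Eq34CovCurlVector.covCurl` ∕ `covCoCurl` ∕ `covLapPrincipal`): the principal part `D*D` of (3.10)
# plus `DD*` IS the componentwise covariant Laplacian (3.23) of the bond field (KATO FORM: diagonal `2d·c²`, each of the `2d` neighbours transported once)
# minus `c²` times a ZEROTH-ORDER operator `𝒦` whose coefficients are differences of the two transports around the plaquettes `p′_μν(x)` — (135),
# letter for letter, with no hypothesis on `R`, `S` at all

statement-level skeleton of published theorems with citation tags; proofs where landed; nothing here is a claim about the Yang–Mills mass gap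

CITATION HEADER (lean-in-tree rule).  Audit cell `pub-balaban`, sub-cell `t4`, BINDER row NE9; filed by the NE9 BINDER-row OWNER lineage
`b2b-balaban-t4-ne9-p1` (gen 92) as stone (K0) of its plan v11 («storey G₁ by Woodbury around the local part A₀ = Δ(U) + DD* + aQ*Q»,
`t4/b2b-balaban-t4-ne9-p1/g91/PLAN-V11-STOREY-G1.md` §1).  Sources READ first-hand: [Balaban1985Variational] p. 298 (PDF p. 22 of
`paper:balaban1985-cmp102-variational-background`), verbatim: *«(Δ + DRD*)A₀ = (D*D + DD*)A₀ + (Δ′ − DPD*)A₀, (134)  (D*DA₀)_μ(x) + (DD*A₀)_μ(x) = (Δ_{U₀}A₀,μ)(x)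
− Σ_{ν=1}^{d} R(U₀(x, x + ηe_μ)U₀(x + ηe_μ, x + ηe_μ − ηe_ν)) · η⁻²[R(U₀(∂p′_μν(x))) − 1]A_ν(x + ηe^ν), (135) where p′_μν(x) = ⟨x + ηe_μ − ηe_ν, x + ηe_μ, x,
x − ηe_ν⟩ … This way we have expressed (Δ + DRD*)A₀ as a sum of Δ_{U₀}A₀ and a bounded operator acting on A₀.»*; [Balaban1985BackgroundPropagators] pp. 390–394
(PDF pp. 2–6 of `paper:balaban1985-cmp99-background-propagators`): (3.3) `D`, (3.4) the curl, (3.8) `D*`, (3.9) the cocurl, (3.10) `Δ = D*D + Δ′`, (3.23)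
`Δ^η_U = D^{η*}_UD^η_U`.

RELATED IN THE TREE, NOT DUPLICATED.  `B11Eq135Weitzenbock` (lit-balaban r08) PROVES (135) on the ABSTRACT shift model of `B9Eq39Adjoint` (sites `S`, shifts
`T μ`, `𝔸`-valued functions, transport `R(W)X = WXW⁻¹`): `eq135`, `eq135η`, with the bound `norm_curvOp_le`.  The NE9 chain's operators (`principalOpK`,
`covDerivL2K ∘ covDivL2K`, `hessOp`, `laplaceAofU`, `G1ofU`) live on the OTHER typing — the periodic carrier `Bond d Pd = TSite d Pd × Fin d` with fibre-valued
functions and transporters as linear DATA `R S : Bond → V →ₗ V` (`B9Eq33CovDerivVector`, `B9Eq34CovCurlVector`, `B11Eq103H1Complex`).  This file proves (135)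
THERE, directly (the cocurl (3.9) of `B9Eq34CovCurlVector` is indexed by ordered pairs `μ < ν`; §2 converts it to print's «last form» `Σ_ν D*_νF_{νμ}`), for
arbitrary `R`, `S` — so it applies verbatim to the chain's `adTransportW φ U`, `adTransportW φ U⁻¹` and to conjugated ∕ complexified transporters alike.
The junction `B9Eq310DeltaPrimeJunction` (dictionary `T μ := shiftEquiv μ`, `U μ x := U (x, μ)`) relates the two typings for `𝔸`-valued functions; it is
not needed here.

WHAT IS DEFINED AND PROVED (sorry-free; [folklore] lattice calculus; no inequality of the paper is asserted).
* §0 `unshift_shift_comm` — `(x + e_μ) − e_ν = (x − e_ν) + e_μ` on the periodic lattice (the corner `z` of `p′_μν(x)`).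
* §1 **`covBondLap c R S`** — `Δ_U` on bond functions COMPONENTWISE: `(Δ_UA)(x, μ) = (D*_SD_R A_μ)(x)` ((3.23) applied to `x ↦ A(x, μ)`; print's
  `(Δ_{U₀}A₀,μ)(x)`), as a linear map; **`covBondLap_apply_eq_sum`** — its KATO FORM `Σ_ν c²[(A(x,μ) − S(x−e_ν,ν)A(x−e_ν,μ)) + (A(x,μ) − R(x,ν)A(x+e_ν,μ))]`
  under `S(b)R(b) = 1` (the twin of `B9Eq323KatoDomination.equiv_covLaplaceSiteK_eq_sum` for bonds).
* §1 **`weitzOp R S`** — the curvature operator `𝒦` of (135) on the carrier: `(𝒦A)(x, μ) = Σ_ν [S(w,ν)R(w,μ) − R(x,μ)S(z,ν)]A(z, ν)`, `w = x − e_ν`,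
  `z = w + e_μ` (print: `R(U₀(x,y)U₀(y,z))·[R(U₀(∂p′_μν(x))) − 1]A_ν(z)`, the two transports from `z` to `x` around `p′`); `weitzOp_summand_self` (the
  `ν = μ` summand vanishes when `S(b)R(b) = R(b)S(b) = 1`).
* §2 `curlAll` (the curl (3.4) on ALL direction pairs, antisymmetric, zero on the diagonal), `sum_filter_snd` ∕ `sum_filter_fst` (the ordered-pair sums of
  the cocurl (3.9) as sums over one direction), **`covLapPrincipal_apply_eq_sum`** — `(D*DA)(x, μ) = c·Σ_ν [S(x−e_ν,ν)(DA)_{νμ}(x−e_ν) − (DA)_{νμ}(x)]`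
  (print's «= Σ_ν (D*_νF_{νμ})(x) … we have assumed F_{μν} = −F_{νμ}», (3.9) last form).
* §3 **`eq135_carrier`** — THE IDENTITY: for every `c`, `R`, `S`, `A` and bond `b`,
  `covLapPrincipal c R S A b + covDeriv c R (covDiv c S A) b = covBondLap c R S A b − (c·c) • weitzOp R S A b`; `eq135_carrier_map` (as linear maps).
* §4 **`norm_weitzOp_apply_le`** — the «bounded operator» clause, in the fibre norm and with a DISPLAYED holonomy letter: if
  `‖(S(w,ν)R(w,μ) − R(x,μ)S(z,ν))v‖ ≤ δ‖v‖` for `μ ≠ ν` and `‖A(b)‖ ≤ a`, then `‖(𝒦A)(x, μ)‖ ≤ (d − 1)·δ·a` (for `R = Ad U` on an Ad-invariant norm,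
  `δ ≤ 2 max‖U(∂p) − 1‖` — `B11Eq135Weitzenbock.norm_R_sub_self_le`; not re-derived here).
HONEST SCOPE.  Finite lattice calculus; the identity is exact and hypothesis-free; nothing of [B9] Thm 3.1∕3.3∕3.11 or of [B11] (136) is asserted; «NE9 ⇐ the
named binders»; NE9 NOT PRINTED ∕ NOT PROVED; row WALLED ON A MODEL (O-NE9-1; #5 UNRULED); spine PROVED 0∕9; rung (B)+1 on a finite T⁴ — NOT infinite volume,
NOT mass gap, NOT BetaPertH, NOT Clay.  HONEST DEPENDENCY: continuum YM on T⁴ ⇐ BetaPertH ∧ nine spine estimates (0/9 proved); BetaPertH ⇐ (D1) ∧ (D4) ∧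
CAP+tail.  NEW file importing `B9Eq34CovCurlVector` only; nothing modified.  Net new unproved facts: 0.
-/

noncomputable section

open scoped BigOperators

namespace Literature.MathematicalPhysics.QuantumFieldTheory.Balaban1983to89.B11Eq135WeitzenbockCarrier

open B9SectCLatticeCarrier (Bond Plaq DirPair shift unshift shift_unshift unshift_shift)
open B9Eq33CovDerivVector (covDeriv covDiv covDeriv_apply_dir covDiv_apply)
open B9Eq34CovCurlVector (covCurl covCoCurl covLapPrincipal covCurl_apply_coord covCoCurl_apply covLapPrincipal_apply shift_comm)
open B4Sect5Torus (TSite)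

variable {d : ℕ} {Pd : Fin d → ℕ} {𝕜 : Type*} [CommRing 𝕜] {V : Type*} [AddCommGroup V] [Module 𝕜 V]

/-! ## §0 Geometry: the corner `z = x + e_μ − e_ν` of `p′_μν(x)` is reached either way -/

/-- `(x + e_μ) − e_ν = (x − e_ν) + e_μ` on the periodic lattice `Π_i ℤ∕P_iℤ`. [folklore] [cite: Balaban1985Variational, (135) p.298] -/
theorem unshift_shift_comm (μ ν : Fin d) (x : TSite d Pd) : unshift ν (shift μ x) = shift μ (unshift ν x) := by
  have h : shift ν (unshift ν (shift μ x)) = shift ν (shift μ (unshift ν x)) := by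
    rw [shift_unshift, shift_comm ν μ, shift_unshift]
  have h' := congrArg (unshift ν) h
  rwa [unshift_shift, unshift_shift] at h'

/-! ## §1 The two operators of (135) on the carrier: `Δ_U` componentwise, and the curvature operator `𝒦` -/

/-- **`Δ_U` ON BOND FUNCTIONS, COMPONENTWISE** — `(Δ_UA)(x, μ) = (D*_SD_RA_μ)(x)`: the covariant Laplace operator (3.23) `D*D` of the site calculus
(`covDiv c S ∘ covDeriv c R`) applied to each component `x ↦ A(x, μ)`; print's `(Δ_{U₀}A₀,μ)(x)` of (135).
[cite: Balaban1985Variational, (135) p.298; Balaban1985BackgroundPropagators, (3.23) p.394] -/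
def covBondLap (c : 𝕜) (R S : Bond d Pd → V →ₗ[𝕜] V) : (Bond d Pd → V) →ₗ[𝕜] (Bond d Pd → V) where
  toFun A b := covDiv c S (covDeriv c R (fun x => A (x, b.2))) b.1
  map_add' A B := by
    funext b
    have h : (fun x => (A + B) (x, b.2)) = (fun x => A (x, b.2)) + (fun x => B (x, b.2)) := rfl
    rw [h, map_add, map_add]; rfl
  map_smul' a A := by
    funext b
    have h : (fun x => (a • A) (x, b.2)) = a • (fun x => A (x, b.2)) := rfl
    rw [h, map_smul, map_smul]; rfl

/-- Unfolding `covBondLap`. [cite: Balaban1985Variational, (135) p.298] -/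
theorem covBondLap_apply (c : 𝕜) (R S : Bond d Pd → V →ₗ[𝕜] V) (A : Bond d Pd → V) (b : Bond d Pd) :
    covBondLap c R S A b = covDiv c S (covDeriv c R (fun x => A (x, b.2))) b.1 := rfl

/-- **KATO FORM of `Δ_U` on bond functions**: under `S(b)R(b) = 1`,
`(Δ_UA)(x, μ) = Σ_ν c²·[(A(x,μ) − S(x−e_ν,ν)A(x−e_ν,μ)) + (A(x,μ) − R(x,ν)A(x+e_ν,μ))]` — diagonal `2d·c²`, each of the `2d` neighbours of the bond
`(x, μ)` (the parallel bonds `(x ± e_ν, μ)`) transported once; the bond twin of `B9Eq323KatoDomination.equiv_covLaplaceSiteK_eq_sum`.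
[cite: Balaban1985BackgroundPropagators, (3.23) p.394; Balaban1985Variational, (135) p.298] -/
theorem covBondLap_apply_eq_sum (c : 𝕜) (R S : Bond d Pd → V →ₗ[𝕜] V) (hSR : ∀ b w, S b (R b w) = w) (A : Bond d Pd → V)
    (x : TSite d Pd) (μ : Fin d) :
    covBondLap c R S A (x, μ) =
      ∑ ν, (c * c) • ((A (x, μ) - S (unshift ν x, ν) (A (unshift ν x, μ))) + (A (x, μ) - R (x, ν) (A (shift ν x, μ)))) := by
  rw [covBondLap_apply, covDiv_apply, Finset.smul_sum]
  refine Finset.sum_congr rfl fun ν _ => ?_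
  rw [covDeriv_apply_dir, covDeriv_apply_dir, shift_unshift, map_smul, map_sub, hSR]
  simp only [smul_sub, smul_add, smul_smul]
  abel

/-- **THE CURVATURE OPERATOR `𝒦` OF (135) ON THE CARRIER**: `(𝒦A)(x, μ) = Σ_ν [S(w,ν)R(w,μ) − R(x,μ)S(z,ν)] A(z, ν)` with `w = x − e_ν`, `z = w + e_μ`
(= `x + e_μ − e_ν`): the difference of the two transports of `A_ν(z)` to `x` around the plaquette `p′_μν(x) = ⟨z, x + e_μ, x, w⟩` — print's
`R(U₀(x, x+ηe_μ)U₀(x+ηe_μ, z))·[R(U₀(∂p′_μν(x))) − 1]A_ν(z)` for `R = Ad U₀`, `S = Ad U₀⁻¹`.  Zeroth order, range one.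
[cite: Balaban1985Variational, (135) p.298] -/
def weitzOp (R S : Bond d Pd → V →ₗ[𝕜] V) : (Bond d Pd → V) →ₗ[𝕜] (Bond d Pd → V) where
  toFun A b := ∑ ν, (S (unshift ν b.1, ν) (R (unshift ν b.1, b.2) (A (shift b.2 (unshift ν b.1), ν))) -
    R b (S (shift b.2 (unshift ν b.1), ν) (A (shift b.2 (unshift ν b.1), ν))))
  map_add' A B := by
    funext b
    simp only [Pi.add_apply, map_add]
    rw [← Finset.sum_add_distrib]
    exact Finset.sum_congr rfl fun ν _ => by abel
  map_smul' a A := by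
    funext b
    simp only [Pi.smul_apply, map_smul, RingHom.id_apply, ← smul_sub, ← Finset.smul_sum]

/-- Unfolding `weitzOp` at the bond `(x, μ)`. [cite: Balaban1985Variational, (135) p.298] -/
theorem weitzOp_apply (R S : Bond d Pd → V →ₗ[𝕜] V) (A : Bond d Pd → V) (x : TSite d Pd) (μ : Fin d) :
    weitzOp R S A (x, μ) = ∑ ν, (S (unshift ν x, ν) (R (unshift ν x, μ) (A (shift μ (unshift ν x), ν))) -
      R (x, μ) (S (shift μ (unshift ν x), ν) (A (shift μ (unshift ν x), ν)))) := rfl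

/-- The `ν = μ` summand of `𝒦` vanishes for mutually inverse transporters (`p′_μμ(x)` is degenerate: `U₀(∂p′_μμ) = 1`).
[cite: Balaban1985Variational, (135) p.298] -/
theorem weitzOp_summand_self (R S : Bond d Pd → V →ₗ[𝕜] V) (hSR : ∀ b w, S b (R b w) = w) (hRS : ∀ b w, R b (S b w) = w)
    (A : Bond d Pd → V) (x : TSite d Pd) (μ : Fin d) :
    S (unshift μ x, μ) (R (unshift μ x, μ) (A (shift μ (unshift μ x), μ))) -
      R (x, μ) (S (shift μ (unshift μ x), μ) (A (shift μ (unshift μ x), μ))) = 0 := by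
  rw [hSR, shift_unshift, hRS, sub_self]

/-! ## §2 The cocurl (3.9) on the carrier in print's «last form» `Σ_ν D*_νF_{νμ}`, and `D*D` bondwise -/

/-- **The curl (3.4) on ALL direction pairs**: `(DA)_{νκ}(x) = c(R(x,ν)A(x+e_ν,κ) − A(x,κ)) − c(R(x,κ)A(x+e_κ,ν) − A(x,ν))` — antisymmetric, zero on the
diagonal; on `ν < κ` it is `B9Eq34CovCurlVector.covCurl` (`covCurl_eq_curlAll`). [cite: Balaban1985BackgroundPropagators, (3.4) p.391] -/
def curlAll (c : 𝕜) (R : Bond d Pd → V →ₗ[𝕜] V) (A : Bond d Pd → V) (ν κ : Fin d) (x : TSite d Pd) : V :=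
  c • (R (x, ν) (A (shift ν x, κ)) - A (x, κ)) - c • (R (x, κ) (A (shift κ x, ν)) - A (x, ν))

/-- Unfolding `curlAll`. [cite: Balaban1985BackgroundPropagators, (3.4) p.391] -/
theorem curlAll_def (c : 𝕜) (R : Bond d Pd → V →ₗ[𝕜] V) (A : Bond d Pd → V) (ν κ : Fin d) (x : TSite d Pd) :
    curlAll c R A ν κ x = c • (R (x, ν) (A (shift ν x, κ)) - A (x, κ)) - c • (R (x, κ) (A (shift κ x, ν)) - A (x, ν)) := rfl

/-- `covCurl` IS `curlAll` on the ordered pairs. [cite: Balaban1985BackgroundPropagators, (3.4) p.391] -/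
theorem covCurl_eq_curlAll (c : 𝕜) (R : Bond d Pd → V →ₗ[𝕜] V) (A : Bond d Pd → V) (x : TSite d Pd) (q : DirPair d) :
    covCurl c R A (x, q) = curlAll c R A q.1.1 q.1.2 x := covCurl_apply_coord c R A x q

/-- «F_{μν}(x) = −F_{νμ}(x)»: `curlAll` is antisymmetric. [cite: Balaban1985BackgroundPropagators, (3.9) p.392] -/
theorem curlAll_swap (c : 𝕜) (R : Bond d Pd → V →ₗ[𝕜] V) (A : Bond d Pd → V) (ν κ : Fin d) (x : TSite d Pd) :
    curlAll c R A κ ν x = -curlAll c R A ν κ x := by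
  rw [curlAll_def, curlAll_def, neg_sub]

/-- `curlAll` vanishes on the diagonal. [cite: Balaban1985BackgroundPropagators, (3.9) p.392] -/
theorem curlAll_self (c : 𝕜) (R : Bond d Pd → V →ₗ[𝕜] V) (A : Bond d Pd → V) (κ : Fin d) (x : TSite d Pd) :
    curlAll c R A κ κ x = 0 := by
  rw [curlAll_def, sub_self]

/-- The sum over the ordered pairs `(ν, κ)` with SECOND index `κ` is a sum over `ν < κ`. [folklore]
[cite: Balaban1985BackgroundPropagators, (3.9) p.392] -/
theorem sum_filter_snd (κ : Fin d) (G : DirPair d → V) :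
    ∑ q ∈ Finset.univ.filter (fun q : DirPair d => q.1.2 = κ), G q = ∑ ν, if h : ν < κ then G ⟨(ν, κ), h⟩ else 0 := by
  have hR : (∑ ν, if h : ν < κ then G ⟨(ν, κ), h⟩ else 0) =
      ∑ ν ∈ Finset.univ.filter (fun ν : Fin d => ν < κ), if h : ν < κ then G ⟨(ν, κ), h⟩ else 0 := by
    rw [Finset.sum_filter]
    refine Finset.sum_congr rfl fun ν _ => ?_
    by_cases h : ν < κ
    · rw [if_pos h]
    · rw [if_neg h, dif_neg h]
  rw [hR]
  refine Finset.sum_bij' (fun q _ => q.1.1) (fun ν hν => ⟨(ν, κ), (Finset.mem_filter.1 hν).2⟩) ?_ ?_ ?_ ?_ ?_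
  · intro q hq
    exact Finset.mem_filter.2 ⟨Finset.mem_univ _, q.2.trans_eq (Finset.mem_filter.1 hq).2⟩
  · intro ν hν
    exact Finset.mem_filter.2 ⟨Finset.mem_univ _, rfl⟩
  · intro q hq
    exact Subtype.ext (Prod.ext rfl ((Finset.mem_filter.1 hq).2).symm)
  · intro ν hν
    rfl
  · intro q hq
    have h2 : q.1.2 = κ := (Finset.mem_filter.1 hq).2
    have hlt : q.1.1 < κ := q.2.trans_eq h2
    rw [dif_pos hlt]
    congr 1
    exact Subtype.ext (Prod.ext rfl h2)

/-- The sum over the ordered pairs `(κ, ν)` with FIRST index `κ` is a sum over `ν > κ`. [folklore]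
[cite: Balaban1985BackgroundPropagators, (3.9) p.392] -/
theorem sum_filter_fst (κ : Fin d) (G : DirPair d → V) :
    ∑ q ∈ Finset.univ.filter (fun q : DirPair d => q.1.1 = κ), G q = ∑ ν, if h : κ < ν then G ⟨(κ, ν), h⟩ else 0 := by
  have hR : (∑ ν, if h : κ < ν then G ⟨(κ, ν), h⟩ else 0) =
      ∑ ν ∈ Finset.univ.filter (fun ν : Fin d => κ < ν), if h : κ < ν then G ⟨(κ, ν), h⟩ else 0 := by
    rw [Finset.sum_filter]
    refine Finset.sum_congr rfl fun ν _ => ?_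
    by_cases h : κ < ν
    · rw [if_pos h]
    · rw [if_neg h, dif_neg h]
  rw [hR]
  refine Finset.sum_bij' (fun q _ => q.1.2) (fun ν hν => ⟨(κ, ν), (Finset.mem_filter.1 hν).2⟩) ?_ ?_ ?_ ?_ ?_
  · intro q hq
    exact Finset.mem_filter.2 ⟨Finset.mem_univ _, ((Finset.mem_filter.1 hq).2).symm.trans_lt q.2⟩
  · intro ν hν
    exact Finset.mem_filter.2 ⟨Finset.mem_univ _, rfl⟩
  · intro q hq
    exact Subtype.ext (Prod.ext ((Finset.mem_filter.1 hq).2).symm rfl)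
  · intro ν hν
    rfl
  · intro q hq
    have h1 : q.1.1 = κ := (Finset.mem_filter.1 hq).2
    have hlt : κ < q.1.2 := h1.symm.trans_lt q.2
    rw [dif_pos hlt]
    congr 1
    exact Subtype.ext (Prod.ext h1 rfl)

/-- **`D*D` BONDWISE, print's (3.9) «last form» on (3.4)**: `(D*DA)(x, κ) = c·Σ_ν [S(x−e_ν,ν)(DA)_{νκ}(x−e_ν) − (DA)_{νκ}(x)]` — the ordered-pair cocurl
of `B9Eq34CovCurlVector` rewritten as a sum over ONE direction against the antisymmetric curl on all pairs (the `ν = κ` summand is zero). Every `c`, `R`, `S`.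
[cite: Balaban1985BackgroundPropagators, (3.9)–(3.10) p.392] -/
theorem covLapPrincipal_apply_eq_sum (c : 𝕜) (R S : Bond d Pd → V →ₗ[𝕜] V) (A : Bond d Pd → V) (x : TSite d Pd) (κ : Fin d) :
    covLapPrincipal c R S A (x, κ) =
      c • ∑ ν, (S (unshift ν x, ν) (curlAll c R A ν κ (unshift ν x)) - curlAll c R A ν κ x) := by
  rw [covLapPrincipal_apply, covCoCurl_apply, sum_filter_snd, sum_filter_fst, ← Finset.sum_sub_distrib]
  congr 1
  refine Finset.sum_congr rfl fun ν _ => ?_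
  rcases lt_trichotomy ν κ with h | rfl | h
  · rw [dif_pos h, dif_neg (lt_asymm h), sub_zero, covCurl_eq_curlAll, covCurl_eq_curlAll]
  · simp [curlAll_self]
  · rw [dif_neg (lt_asymm h), dif_pos h, zero_sub, covCurl_eq_curlAll, covCurl_eq_curlAll]
    simp only [curlAll_swap c R A ν κ, map_neg]
    abel

/-! ## §3 (135) on the carrier: `D*D + DD* = Δ_U − c²𝒦`, every `c`, `R`, `S` -/

/-- **(135) ON THE CHAIN's CARRIER, BONDWISE**: for EVERY scalar `c` (= `η⁻¹`), every pair of transporter data `R`, `S` (no relation between them assumed),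
every bond function `A` and every bond `b`:
`(D*_SD_RA)(b) + (D_RD*_SA)(b) = (Δ_UA)(b) − c²·(𝒦A)(b)` — «(D*DA₀)_μ(x) + (DD*A₀)_μ(x) = (Δ_{U₀}A₀,μ)(x) − Σ_ν R(…)·η⁻²[R(U₀(∂p′_μν(x))) − 1]A_ν(…)».
The three values of `A_ν` at `x`, `x + e_μ`, `x − e_ν` cancel between `−D*_νD_μA_ν` and `D_μD*_νA_ν`; the value at the far corner `z = x + e_μ − e_ν` survives,
transported the two ways round `p′_μν(x)`. [cite: Balaban1985Variational, (135) p.298; Balaban1985BackgroundPropagators, (3.10) p.392, (3.23) p.394] -/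
theorem eq135_carrier (c : 𝕜) (R S : Bond d Pd → V →ₗ[𝕜] V) (A : Bond d Pd → V) (b : Bond d Pd) :
    covLapPrincipal c R S A b + covDeriv c R (covDiv c S A) b = covBondLap c R S A b - (c * c) • weitzOp R S A b := by
  obtain ⟨x, κ⟩ := b
  rw [covLapPrincipal_apply_eq_sum, covDeriv_apply_dir, covDiv_apply, covDiv_apply, covBondLap_apply, covDiv_apply, weitzOp_apply,
    map_smul, map_sum, smul_sub, smul_smul, smul_smul, Finset.smul_sum, Finset.smul_sum, Finset.smul_sum, Finset.smul_sum, Finset.smul_sum,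
    ← Finset.sum_sub_distrib, ← Finset.sum_add_distrib, ← Finset.sum_sub_distrib]
  refine Finset.sum_congr rfl fun ν _ => ?_
  rw [curlAll_def, curlAll_def, covDeriv_apply_dir, covDeriv_apply_dir, shift_unshift, unshift_shift_comm κ ν x]
  simp only [map_sub, map_smul, smul_sub, smul_smul]
  abel

/-- **(135) AS AN IDENTITY OF LINEAR MAPS on bond functions**: `D*_SD_R + D_R ∘ D*_S = Δ_U − c²𝒦`. [cite: Balaban1985Variational, (135) p.298] -/
theorem eq135_carrier_map (c : 𝕜) (R S : Bond d Pd → V →ₗ[𝕜] V) :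
    covLapPrincipal c R S + covDeriv c R ∘ₗ covDiv c S = covBondLap c R S - (c * c) • weitzOp R S := by
  apply LinearMap.ext
  intro A
  funext b
  simp only [LinearMap.add_apply, LinearMap.comp_apply, LinearMap.sub_apply, LinearMap.smul_apply, Pi.add_apply, Pi.sub_apply, Pi.smul_apply]
  exact eq135_carrier c R S A b

/-! ## §4 «a bounded operator acting on A₀»: the pointwise bound of `𝒦` with a displayed holonomy letter -/

section Bound

variable {𝕜' : Type*} [NormedField 𝕜'] {W : Type*} [NormedAddCommGroup W] [NormedSpace 𝕜' W]

/-- A finite sum whose `μ`-th term vanishes and whose other terms are bounded by `C` has norm `≤ (d − 1)·C`. [folklore]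
[cite: Balaban1985Variational, (135) p.298] -/
theorem norm_sum_le_of_forall_ne (F : Fin d → W) (μ : Fin d) (C : ℝ) (h0 : F μ = 0) (h : ∀ ν, ν ≠ μ → ‖F ν‖ ≤ C) :
    ‖∑ ν, F ν‖ ≤ (d - 1 : ℝ) * C := by
  classical
  rw [← Finset.sum_erase Finset.univ h0]
  have hcard : ((Finset.univ.erase μ).card : ℝ) = (d - 1 : ℝ) := by
    rw [Finset.card_erase_of_mem (Finset.mem_univ μ), Finset.card_univ, Fintype.card_fin,
      Nat.cast_sub (Nat.succ_le_of_lt (Fin.pos μ)), Nat.cast_one]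
  calc ‖∑ ν ∈ Finset.univ.erase μ, F ν‖ ≤ ∑ ν ∈ Finset.univ.erase μ, ‖F ν‖ := norm_sum_le _ _
    _ ≤ ∑ _ν ∈ Finset.univ.erase μ, C := Finset.sum_le_sum fun ν hν => h ν (Finset.ne_of_mem_erase hν)
    _ = (d - 1 : ℝ) * C := by rw [Finset.sum_const, nsmul_eq_mul, hcard]

/-- **THE CURVATURE OPERATOR IS BOUNDED, POINTWISE** («This way we have expressed (Δ + DRD*)A₀ as a sum of Δ_{U₀}A₀ and a bounded operator acting on A₀.
The bound for this operator follows from … the regularity condition (14)»): with mutually inverse transporters, the HOLONOMY LETTER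
`‖(S(w,ν)R(w,μ) − R(x,μ)S(z,ν))v‖ ≤ δ‖v‖` for `μ ≠ ν`, `0 ≤ δ` (for `R = Ad U₀` on an Ad-invariant fibre norm `δ ≤ 2·max_p‖U₀(∂p) − 1‖`) and `‖A(b)‖ ≤ a`:
`‖(𝒦A)(x, μ)‖ ≤ (d − 1)·δ·a`. [cite: Balaban1985Variational, (135)–(136) p.298] -/
theorem norm_weitzOp_apply_le (R S : Bond d Pd → W →ₗ[𝕜'] W) (hSR : ∀ b w, S b (R b w) = w) (hRS : ∀ b w, R b (S b w) = w) {δ a : ℝ}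
    (hδ : 0 ≤ δ)
    (hHol : ∀ (x : TSite d Pd) (μ ν : Fin d), μ ≠ ν → ∀ v : W,
      ‖S (unshift ν x, ν) (R (unshift ν x, μ) v) - R (x, μ) (S (shift μ (unshift ν x), ν) v)‖ ≤ δ * ‖v‖)
    {A : Bond d Pd → W} (hA : ∀ b, ‖A b‖ ≤ a) (x : TSite d Pd) (μ : Fin d) :
    ‖weitzOp R S A (x, μ)‖ ≤ (d - 1 : ℝ) * δ * a := by
  rw [weitzOp_apply]
  have hmain := norm_sum_le_of_forall_ne
    (fun ν => S (unshift ν x, ν) (R (unshift ν x, μ) (A (shift μ (unshift ν x), ν))) -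
      R (x, μ) (S (shift μ (unshift ν x), ν) (A (shift μ (unshift ν x), ν)))) μ (δ * a)
    (weitzOp_summand_self R S hSR hRS A x μ) (fun ν hne =>
      (hHol x μ ν hne.symm (A (shift μ (unshift ν x), ν))).trans (mul_le_mul_of_nonneg_left (hA _) hδ))
  exact hmain.trans (le_of_eq (by ring))

end Bound

end Literature.MathematicalPhysics.QuantumFieldTheory.Balaban1983to89.B11Eq135WeitzenbockCarrier

end
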